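import Literature.MathematicalPhysics.QuantumManyBody.PeriodicFeynmanKacEnergyLower
import Mathlib.Topology.UniformSpace.HeineCantor
import HarnessLib

/-!
# Periodic Feynman–Kac: the free form of an eigenfunction (`limsup sqIncrCell/(2t) ≤ λ - ∫V^perΨ₀²`)

Topic `Literature/MathematicalPhysics/QuantumManyBody`; theorems only. Support file for the proof
of the named fact `Literature.MathematicalPhysics.QuantumManyBody.BoseGas.PeriodicGroundStateFeynmanKac`
(`PeriodicHeatFlowSpectral.lean`), torus twin of Part II of `GroundStateFeynmanKacProofs.lean`:
second half of the variational identification of the top of the spectrum of the torus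
Feynman–Kac semigroup (Chung–Zhao (1995) Thm 3.27, Prop 3.29, on the torus). If a continuous
nonnegative PERIODIC `Ψ₀` with `∫_cell Ψ₀² = 1` satisfies the (integrated) eigen-relation
`e^{-λt} ≤ ⟨Ψ₀, e^{-tH} Ψ₀⟩_cell` for all `t > 0`, then its free small-time form on the cell is
asymptotically at most `λ - ∫_cell V^per Ψ₀²`:

* `eigen_pairing_upper_bound_periodic` — the master inequality: for `t > 0` small and any
  `ε, δ` with `‖h‖ < δ ⇒ |Ψ₀(Y + h) - Ψ₀(Y)| ≤ ε`,
  `⟨Ψ₀, T_tΨ₀⟩_cell ≤ (1 - sqIncrCell t Ψ₀/2) - t ∫_cell V^perΨ₀² + t·(explicit small) + (N²C t)²`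
  (weight `w = e^{-∫₀ᵗV^per} ≤ 1 - ∫₀ᵗV^per + (∫₀ᵗV^per)²`, the square identity on the cell, shift
  invariance of cell integrals, uniform continuity of `Ψ₀` and Markov's inequality for `‖√2 b_s‖`);
* `sqIncrCell_div_eventually_le` — consequently, for every `K' > λ - ∫_cell V^per Ψ₀²`, eventually as
  `t → 0⁺`, `sqIncrCell t Ψ₀ / (2t) ≤ K'`;
* `setIntegral_cellN_sq_mul_periodicInteraction_le` — `∫_cell Ψ₀² V^per ≤ λ`.

## References

* K. L. Chung, Z. Zhao, *From Brownian Motion to Schrödinger's Equation* (1995), Thm 3.27,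
  Prop 3.29 (81). [ChungZhao1995]
-/

noncomputable section

namespace Literature.MathematicalPhysics.QuantumManyBody.BoseGas

open MeasureTheory ProbabilityTheory Filter Set
open scoped ENNReal NNReal Topology
open Literature.Probability.Process

variable {N : ℕ}

/-! ### Uniform continuity of continuous periodic functions -/

/-- A closed coordinate box `{X | X_{ik} ∈ [a, b]}` of configuration space is compact. [folklore] -/
theorem isCompact_coordBox (N : ℕ) (a b : ℝ) :
    IsCompact {X : Config N | ∀ i k, X i k ∈ Set.Icc a b} := by
  refine Metric.isCompact_of_isClosed_isBounded ?_ ?_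
  · have hset : {X : Config N | ∀ i k, X i k ∈ Set.Icc a b} =
        ⋂ i : Fin N, ⋂ k : Fin 3, (fun X : Config N => X i k) ⁻¹' Set.Icc a b := by
      ext X; simp
    rw [hset]
    exact isClosed_iInter fun i => isClosed_iInter fun k =>
      isClosed_Icc.preimage ((PiLp.continuous_apply 2 _ k).comp (continuous_apply i))
  · refine isBounded_iff_forall_norm_le.2 ⟨Real.sqrt 3 * (|a| + |b|), fun X hX => ?_⟩
    refine (pi_norm_le_iff_of_nonneg (by positivity)).2 fun i => ?_
    rw [EuclideanSpace.norm_eq]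
    have hk : ∀ k : Fin 3, ‖X i k‖ ^ 2 ≤ (|a| + |b|) ^ 2 := fun k => by
      have h := (hX i) k
      rw [Real.norm_eq_abs, sq_le_sq, abs_abs, abs_of_nonneg (by positivity : (0 : ℝ) ≤ |a| + |b|)]
      exact abs_le.2 ⟨by linarith [neg_abs_le a, h.1, abs_nonneg b], h.2.trans ((le_abs_self b).trans (by linarith [abs_nonneg a]))⟩
    calc Real.sqrt (∑ k, ‖X i k‖ ^ 2) ≤ Real.sqrt (∑ _k : Fin 3, (|a| + |b|) ^ 2) :=
          Real.sqrt_le_sqrt (Finset.sum_le_sum fun k _ => hk k)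
      _ = Real.sqrt 3 * (|a| + |b|) := by
          rw [Finset.sum_const, Finset.card_univ, Fintype.card_fin, nsmul_eq_mul, Nat.cast_ofNat,
            Real.sqrt_mul (by norm_num), Real.sqrt_sq (by positivity)]

/-- A coordinate is bounded by the norm of the configuration. [folklore] -/
theorem abs_coord_le_norm (Y : Config N) (i : Fin N) (k : Fin 3) : |Y i k| ≤ ‖Y‖ := by
  have h1 : |Y i k| ≤ ‖Y i‖ := by
    have := PiLp.norm_apply_le (Y i) k
    simpa using this
  exact h1.trans (norm_le_pi_norm Y i)

/-- **A continuous periodic function is uniformly continuous** (`ε`-`δ` form): for `ε > 0` there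
is `δ > 0` with `|Ψ₀(Y + h) - Ψ₀(Y)| ≤ ε` for all `Y` and all `‖h‖ < δ` (reduce `Y` to the cell and
apply Heine–Cantor on the compact box `[-1, L+1]^{3N}`). [folklore] -/
theorem periodic_uniformContinuous {L : ℝ} (hL : 0 < L) {Ψ₀ : Config N → ℝ} (hcont : Continuous Ψ₀)
    (hper : ∀ (X : Config N) (i : Fin N) (k : Fin 3),
      Ψ₀ (X + Pi.single i (EuclideanSpace.single k L)) = Ψ₀ X)
    {ε : ℝ} (hε : 0 < ε) :
    ∃ δ > 0, ∀ Y h : Config N, ‖h‖ < δ → |Ψ₀ (Y + h) - Ψ₀ Y| ≤ ε := by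
  set K : Set (Config N) := {X : Config N | ∀ i k, X i k ∈ Set.Icc (-1) (L + 1)} with hK
  have hKc : IsCompact K := isCompact_coordBox N (-1) (L + 1)
  have hUC := hKc.uniformContinuousOn_of_continuous hcont.continuousOn
  obtain ⟨δ₀, hδ₀, hδUC⟩ := Metric.uniformContinuousOn_iff.1 hUC ε hε
  refine ⟨min δ₀ 1, lt_min hδ₀ one_pos, fun Y h hh => ?_⟩
  have hhδ : ‖h‖ < δ₀ := hh.trans_le (min_le_left _ _)
  have hh1 : ‖h‖ < 1 := hh.trans_le (min_le_right _ _)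
  -- reduce `Y` to the cell
  set Y' : Config N := cellProj L Y with hY'
  have hY'mem : Y' ∈ cellN N L := cellProj_mem_cellN hL Y
  have hval : Ψ₀ (Y + h) - Ψ₀ Y = Ψ₀ (Y' + h) - Ψ₀ Y' := by
    have h1 : Y = Y' + latticeVecN L (cellIndex L Y) := (cellProj_add_latticeVecN_cellIndex L Y).symm
    rw [h1, add_right_comm, apply_add_latticeVecN_of_periodic hper,
      apply_add_latticeVecN_of_periodic hper]
  rw [hval]
  have hY'K : Y' ∈ K := fun i k => ⟨by linarith [(hY'mem i k).1], by linarith [(hY'mem i k).2]⟩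
  have hYhK : Y' + h ∈ K := by
    intro i k
    have hc : |h i k| ≤ ‖h‖ := abs_coord_le_norm h i k
    have h1 := (hY'mem i k).1
    have h2 := (hY'mem i k).2
    have hhik := abs_le.1 (hc.trans hh1.le)
    simp only [Pi.add_apply, PiLp.add_apply, Set.mem_Icc]
    constructor <;> linarith [hhik.1, hhik.2]
  have := hδUC (Y' + h) hYhK Y' hY'K (by rwa [dist_eq_norm, add_sub_cancel_left])
  rw [Real.dist_eq] at this
  exact this.le

/-! ### Pointwise weight bounds -/

/-- `w_t(X, ω) = e^{-∫₀ᵗ V^per}` for a bounded periodised potential (real form). [folklore] -/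
theorem toReal_periodicFKWeight_eq_exp {v : ℝ → ℝ≥0∞} {L : ℝ} {C : ℝ≥0}
    (hC : ∀ x, periodizedPotential v L x ≤ C) (t : ℝ) (X : Config N) (ω : PathSpace N) :
    (periodicFKWeight v L t X ω).toReal = Real.exp (-(periodicPathAction v L t X ω).toReal) := by
  rw [periodicFKWeight, expNeg, if_neg (periodicPathAction_ne_top hC t X ω),
    ENNReal.toReal_ofReal (Real.exp_pos _).le]

/-- `e^{-a} ≤ 1 - a + a²` for `0 ≤ a ≤ 1`. [folklore] -/
theorem exp_neg_le_one_sub_add_sq_periodic {a : ℝ} (ha0 : 0 ≤ a) (ha1 : a ≤ 1) :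
    Real.exp (-a) ≤ 1 - a + a ^ 2 := by
  have h := Real.abs_exp_sub_one_sub_id_le (x := -a) (by rw [abs_neg, abs_of_nonneg ha0]; exact ha1)
  rw [neg_sq] at h
  linarith [(abs_le.1 h).2]

/-- **Pointwise upper bound for the eigen-pairing integrand** (nonnegative `Ψ₀`, action
`a = ∫₀ᵗV^per ≤ N²Ct ≤ 1`): `Ψ₀(X) w Ψ₀(Y) ≤ Ψ₀(X)Ψ₀(Y) - Ψ₀(X)² a + Ψ₀(X)|Ψ₀(Y) - Ψ₀(X)| N²Ct
+ Ψ₀(X)Ψ₀(Y) (N²Ct)²`. [folklore] -/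
theorem eigen_integrand_le_periodic {v : ℝ → ℝ≥0∞} {L : ℝ} {C : ℝ≥0}
    (hC : ∀ x, periodizedPotential v L x ≤ C) {t : ℝ} (ht : 0 ≤ t)
    (hsmall : ((N * N : ℕ) : ℝ) * C * t ≤ 1) {Ψ₀ : Config N → ℝ} (hnn : ∀ X, 0 ≤ Ψ₀ X)
    (X : Config N) (ω : PathSpace N) (Y : Config N) :
    Ψ₀ X * ((periodicFKWeight v L t X ω).toReal * Ψ₀ Y) ≤
      Ψ₀ X * Ψ₀ Y - Ψ₀ X ^ 2 * (periodicPathAction v L t X ω).toReal +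
        Ψ₀ X * |Ψ₀ Y - Ψ₀ X| * (((N * N : ℕ) : ℝ) * C * t) +
        Ψ₀ X * Ψ₀ Y * (((N * N : ℕ) : ℝ) * C * t) ^ 2 := by
  set CVt : ℝ := ((N * N : ℕ) : ℝ) * C * t with hCVt
  have hA : periodicPathAction v L t X ω ≤ (N * N : ℕ) * (C : ℝ≥0∞) * ENNReal.ofReal t :=
    periodicPathAction_le_of_bound (C := (C : ℝ≥0∞)) (fun x => hC x) t X ω
  set a := (periodicPathAction v L t X ω).toReal with ha
  have ha0 : 0 ≤ a := ENNReal.toReal_nonneg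
  have haCV : a ≤ CVt := by
    have := ENNReal.toReal_mono (ENNReal.mul_ne_top (ENNReal.mul_ne_top (ENNReal.natCast_ne_top _)
      ENNReal.coe_ne_top) ENNReal.ofReal_ne_top) hA
    rw [ENNReal.toReal_mul, ENNReal.toReal_mul, ENNReal.toReal_ofReal ht] at this
    simpa [hCVt] using this
  have ha1 : a ≤ 1 := haCV.trans hsmall
  have hw : (periodicFKWeight v L t X ω).toReal ≤ Real.exp (-a) :=
    (toReal_periodicFKWeight_eq_exp hC t X ω).le
  have hexp := exp_neg_le_one_sub_add_sq_periodic ha0 ha1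
  have hP : 0 ≤ Ψ₀ X * Ψ₀ Y := mul_nonneg (hnn X) (hnn Y)
  -- `Ψ₀X w Ψ₀Y ≤ Ψ₀X Ψ₀Y (1 - a + a²)`
  have h1 : Ψ₀ X * ((periodicFKWeight v L t X ω).toReal * Ψ₀ Y) ≤ Ψ₀ X * Ψ₀ Y * (1 - a + a ^ 2) := by
    calc Ψ₀ X * ((periodicFKWeight v L t X ω).toReal * Ψ₀ Y)
        = Ψ₀ X * Ψ₀ Y * (periodicFKWeight v L t X ω).toReal := by ring
      _ ≤ Ψ₀ X * Ψ₀ Y * (1 - a + a ^ 2) := mul_le_mul_of_nonneg_left (hw.trans hexp) hP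
  -- `-Ψ₀X Ψ₀Y a ≤ -Ψ₀X² a + Ψ₀X |Ψ₀Y - Ψ₀X| a`
  have h2 : -(Ψ₀ X * Ψ₀ Y * a) ≤ -(Ψ₀ X ^ 2 * a) + Ψ₀ X * |Ψ₀ Y - Ψ₀ X| * CVt := by
    have h3 : Ψ₀ X * (Ψ₀ X - Ψ₀ Y) * a ≤ Ψ₀ X * |Ψ₀ Y - Ψ₀ X| * CVt := by
      calc Ψ₀ X * (Ψ₀ X - Ψ₀ Y) * a ≤ Ψ₀ X * |Ψ₀ Y - Ψ₀ X| * a := by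
            refine mul_le_mul_of_nonneg_right (mul_le_mul_of_nonneg_left ?_ (hnn X)) ha0
            rw [abs_sub_comm]; exact le_abs_self _
        _ ≤ Ψ₀ X * |Ψ₀ Y - Ψ₀ X| * CVt :=
            mul_le_mul_of_nonneg_left haCV (mul_nonneg (hnn X) (abs_nonneg _))
    nlinarith [h3]
  -- `a² ≤ CVt²`
  have h4 : Ψ₀ X * Ψ₀ Y * a ^ 2 ≤ Ψ₀ X * Ψ₀ Y * CVt ^ 2 :=
    mul_le_mul_of_nonneg_left (pow_le_pow_left₀ ha0 haCV 2) hP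
  nlinarith [h1, h2, h4]

/-! ### The translated-mass error and Markov -/

/-- **`L¹(cell)`-continuity of `Ψ₀²` under translation, quantitatively**: if `‖h‖ < δ ⇒
|Ψ₀(Y + h) - Ψ₀(Y)| ≤ ε` and `Ψ₀` is periodic, then for every `h`,
`∫_cell |Ψ₀(Y - h)² - Ψ₀(Y)²| dY ≤ 2ε‖Ψ₀‖_{L¹(cell)} + 𝟙{δ ≤ ‖h‖} · 2∫_cellΨ₀²`. [folklore] -/
theorem setLIntegral_cellN_abs_sq_shift_sub_le {L : ℝ} (hL : 0 < L) {Ψ₀ : Config N → ℝ}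
    (hΨm : Measurable Ψ₀)
    (hper : ∀ (X : Config N) (i : Fin N) (k : Fin 3),
      Ψ₀ (X + Pi.single i (EuclideanSpace.single k L)) = Ψ₀ X)
    {ε δ : ℝ} (hε : 0 ≤ ε) (hUC : ∀ Y h, ‖h‖ < δ → |Ψ₀ (Y + h) - Ψ₀ Y| ≤ ε) (h : Config N) :
    ∫⁻ Y in cellN N L, ‖Ψ₀ (Y - h) ^ 2 - Ψ₀ Y ^ 2‖ₑ ≤
      ENNReal.ofReal (2 * ε) * (∫⁻ Y in cellN N L, ‖Ψ₀ Y‖ₑ) +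
        {h : Config N | δ ≤ ‖h‖}.indicator (fun _ => (2 : ℝ≥0∞)) h *
          ∫⁻ Y in cellN N L, ENNReal.ofReal (Ψ₀ Y ^ 2) := by
  have hme : Measurable fun Y : Config N => ‖Ψ₀ Y‖ₑ := hΨm.enorm
  have hmeh : Measurable fun Y : Config N => ‖Ψ₀ (Y - h)‖ₑ := (hΨm.comp (measurable_sub_const h)).enorm
  have htr1 : ∫⁻ Y in cellN N L, ‖Ψ₀ (Y - h)‖ₑ = ∫⁻ Y in cellN N L, ‖Ψ₀ Y‖ₑ := by
    have := lintegral_cellN_comp_add hL (G := fun Y => ‖Ψ₀ Y‖ₑ) (fun Y i k => by simp only [hper]) (-h)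
    simpa only [← sub_eq_add_neg] using this
  have htr2 : ∫⁻ Y in cellN N L, ENNReal.ofReal (Ψ₀ (Y - h) ^ 2) = ∫⁻ Y in cellN N L, ENNReal.ofReal (Ψ₀ Y ^ 2) := by
    have := lintegral_cellN_comp_add hL (G := fun Y => ENNReal.ofReal (Ψ₀ Y ^ 2))
      (fun Y i k => by simp only [hper]) (-h)
    simpa only [← sub_eq_add_neg] using this
  by_cases hh : ‖h‖ < δ
  · -- small shift: uniform continuity
    rw [Set.indicator_of_notMem (show h ∉ {h : Config N | δ ≤ ‖h‖} from fun hm => absurd hm (not_le.2 hh)),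
      zero_mul, add_zero]
    have hpt : ∀ Y, ‖Ψ₀ (Y - h) ^ 2 - Ψ₀ Y ^ 2‖ₑ ≤ ENNReal.ofReal ε * (‖Ψ₀ (Y - h)‖ₑ + ‖Ψ₀ Y‖ₑ) := by
      intro Y
      have hd : |Ψ₀ (Y - h) - Ψ₀ Y| ≤ ε := by
        have := hUC (Y - h) h (by simpa using hh)
        rw [sub_add_cancel] at this
        rwa [abs_sub_comm] at this
      have h1 : |Ψ₀ (Y - h) ^ 2 - Ψ₀ Y ^ 2| ≤ ε * (|Ψ₀ (Y - h)| + |Ψ₀ Y|) := by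
        rw [show Ψ₀ (Y - h) ^ 2 - Ψ₀ Y ^ 2 = (Ψ₀ (Y - h) - Ψ₀ Y) * (Ψ₀ (Y - h) + Ψ₀ Y) by ring, abs_mul]
        exact mul_le_mul hd (abs_add_le _ _) (abs_nonneg _) hε
      calc ‖Ψ₀ (Y - h) ^ 2 - Ψ₀ Y ^ 2‖ₑ = ENNReal.ofReal |Ψ₀ (Y - h) ^ 2 - Ψ₀ Y ^ 2| :=
            Real.enorm_eq_ofReal_abs _
        _ ≤ ENNReal.ofReal (ε * (|Ψ₀ (Y - h)| + |Ψ₀ Y|)) := ENNReal.ofReal_le_ofReal h1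
        _ = _ := by
            rw [ENNReal.ofReal_mul hε, ENNReal.ofReal_add (abs_nonneg _) (abs_nonneg _),
              ← Real.enorm_eq_ofReal_abs, ← Real.enorm_eq_ofReal_abs]
    have hsum : Measurable fun Y : Config N => ‖Ψ₀ (Y - h)‖ₑ + ‖Ψ₀ Y‖ₑ := hmeh.add hme
    calc ∫⁻ Y in cellN N L, ‖Ψ₀ (Y - h) ^ 2 - Ψ₀ Y ^ 2‖ₑ
        ≤ ∫⁻ Y in cellN N L, ENNReal.ofReal ε * (‖Ψ₀ (Y - h)‖ₑ + ‖Ψ₀ Y‖ₑ) := lintegral_mono hpt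
      _ = ENNReal.ofReal ε * ((∫⁻ Y in cellN N L, ‖Ψ₀ (Y - h)‖ₑ) + ∫⁻ Y in cellN N L, ‖Ψ₀ Y‖ₑ) := by
          rw [lintegral_const_mul _ hsum, lintegral_add_left hmeh]
      _ = ENNReal.ofReal (2 * ε) * ∫⁻ Y in cellN N L, ‖Ψ₀ Y‖ₑ := by
          rw [htr1, ← two_mul, ← mul_assoc, ENNReal.ofReal_mul zero_le_two, ENNReal.ofReal_ofNat, mul_comm _ 2]
  · -- large shift: crude bound `|u(Y-h) - u(Y)| ≤ u(Y-h) + u(Y)`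
    rw [Set.indicator_of_mem (show h ∈ {h : Config N | δ ≤ ‖h‖} from not_lt.1 hh)]
    have hpt : ∀ Y, ‖Ψ₀ (Y - h) ^ 2 - Ψ₀ Y ^ 2‖ₑ ≤
        ENNReal.ofReal (Ψ₀ (Y - h) ^ 2) + ENNReal.ofReal (Ψ₀ Y ^ 2) := by
      intro Y
      rw [Real.enorm_eq_ofReal_abs, ← ENNReal.ofReal_add (sq_nonneg _) (sq_nonneg _)]
      refine ENNReal.ofReal_le_ofReal ?_
      have h1 := sq_nonneg (Ψ₀ (Y - h))
      have h2 := sq_nonneg (Ψ₀ Y)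
      exact abs_sub_le_iff.2 ⟨by linarith, by linarith⟩
    have hm2 : Measurable fun Y : Config N => ENNReal.ofReal (Ψ₀ (Y - h) ^ 2) :=
      ENNReal.measurable_ofReal.comp ((hΨm.comp (measurable_sub_const h)).pow_const 2)
    calc ∫⁻ Y in cellN N L, ‖Ψ₀ (Y - h) ^ 2 - Ψ₀ Y ^ 2‖ₑ
        ≤ ∫⁻ Y in cellN N L, (ENNReal.ofReal (Ψ₀ (Y - h) ^ 2) + ENNReal.ofReal (Ψ₀ Y ^ 2)) := lintegral_mono hpt
      _ = 2 * ∫⁻ Y in cellN N L, ENNReal.ofReal (Ψ₀ Y ^ 2) := by rw [lintegral_add_left hm2, htr2, two_mul]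
      _ ≤ _ := le_add_self

/-- **Markov for the displacement**: `P(δ ≤ ‖√2 b_s‖) ≤ (√2 · 3N · 2√t)/δ` for `s ≤ t`, `δ > 0`.
[folklore] -/
theorem measure_norm_displacement_ge_le_periodic {s t : ℝ≥0} (hs : s ≤ t) {δ : ℝ} (hδ : 0 < δ) :
    wienerPaths N {ω | δ ≤ ‖displacement s ω‖} ≤
      ENNReal.ofReal (Real.sqrt 2 * ((3 * N : ℕ) * (2 * Real.sqrt t)) / δ) := by
  have hm := mul_meas_ge_le_lintegral (μ := wienerPaths N) (measurable_displacement (N := N) s).enorm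
    (ENNReal.ofReal δ)
  have hset : {ω : PathSpace N | ENNReal.ofReal δ ≤ ‖displacement s ω‖ₑ} = {ω | δ ≤ ‖displacement s ω‖} := by
    ext ω
    simp only [Set.mem_setOf_eq]
    rw [← ofReal_norm, ENNReal.ofReal_le_ofReal_iff (norm_nonneg _)]
  rw [hset] at hm
  have hb := hm.trans (lintegral_norm_displacement_le hs)
  have hδ' : ENNReal.ofReal δ ≠ 0 := (ENNReal.ofReal_pos.2 hδ).ne'
  calc wienerPaths N {ω | δ ≤ ‖displacement s ω‖}
      = (ENNReal.ofReal δ)⁻¹ * (ENNReal.ofReal δ * wienerPaths N {ω | δ ≤ ‖displacement s ω‖}) := by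
        rw [← mul_assoc, ENNReal.inv_mul_cancel hδ' ENNReal.ofReal_ne_top, one_mul]
    _ ≤ (ENNReal.ofReal δ)⁻¹ * ENNReal.ofReal (Real.sqrt 2 * ((3 * N : ℕ) * (2 * Real.sqrt t))) :=
        mul_le_mul' le_rfl hb
    _ = _ := by
        rw [mul_comm, ← div_eq_mul_inv, ENNReal.ofReal_div_of_pos hδ]

/-! ### The main term from below -/

/-- **The potential term of a nonnegative periodic `Ψ₀` from below** (in `[0, ∞]`):
with `P = ∫_cell Ψ₀² V^per`, `I₁ = ∫_cell Ψ₀`, `m = √2·3N·2√t` and `‖h‖<δ ⇒ |Ψ₀(Y+h)-Ψ₀(Y)| ≤ ε`,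
`t · P ≤ ∫_cell dX E[Ψ₀(X)² ∫₀ᵗ V^per(B_s)ds] + t · N²C · (2εI₁ + 2(∫_cellΨ₀²) m/δ)`. [folklore] -/
theorem ofReal_mul_potential_le_periodic {v : ℝ → ℝ≥0∞} (hv : Measurable v) {L : ℝ} (hL : 0 < L)
    {C : ℝ≥0} (hC : ∀ x, periodizedPotential v L x ≤ C) {Ψ₀ : Config N → ℝ} (hΨm : Measurable Ψ₀)
    (hper : ∀ (X : Config N) (i : Fin N) (k : Fin 3),
      Ψ₀ (X + Pi.single i (EuclideanSpace.single k L)) = Ψ₀ X)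
    {ε δ : ℝ} (hε : 0 ≤ ε) (hδ : 0 < δ) (hUC : ∀ Y h, ‖h‖ < δ → |Ψ₀ (Y + h) - Ψ₀ Y| ≤ ε)
    (t : ℝ≥0) :
    ENNReal.ofReal t * ∫⁻ X in cellN N L, ENNReal.ofReal (Ψ₀ X ^ 2) * periodicInteraction v L X ≤
      (∫⁻ X in cellN N L, ∫⁻ ω, ENNReal.ofReal (Ψ₀ X ^ 2) * periodicPathAction v L t X ω ∂wienerPaths N ∂volume) +
        ENNReal.ofReal t * (((N * N : ℕ) * C : ℝ≥0) : ℝ≥0∞) *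
          (ENNReal.ofReal (2 * ε) * (∫⁻ Y in cellN N L, ‖Ψ₀ Y‖ₑ) +
            2 * ENNReal.ofReal (Real.sqrt 2 * ((3 * N : ℕ) * (2 * Real.sqrt t)) / δ) *
              ∫⁻ Y in cellN N L, ENNReal.ofReal (Ψ₀ Y ^ 2)) := by
  set CV : ℝ≥0 := (N * N : ℕ) * C with hCVdef
  set P : ℝ≥0∞ := ∫⁻ X in cellN N L, ENNReal.ofReal (Ψ₀ X ^ 2) * periodicInteraction v L X with hP
  set I₁ : ℝ≥0∞ := ∫⁻ Y in cellN N L, ‖Ψ₀ Y‖ₑ with hI₁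
  set U : ℝ≥0∞ := ∫⁻ Y in cellN N L, ENNReal.ofReal (Ψ₀ Y ^ 2) with hU
  set m : ℝ := Real.sqrt 2 * ((3 * N : ℕ) * (2 * Real.sqrt t)) with hm
  have hVm : Measurable (periodicInteraction (N := N) v L) := measurable_periodicInteraction hv L
  have hVle : ∀ X : Config N, periodicInteraction v L X ≤ CV := fun X => by
    have := periodicInteraction_le_of_bound (C := (C : ℝ≥0∞)) (fun x => hC x) X
    simpa [hCVdef] using this
  -- lower bound of the shifted potential integral for a fixed shift `h`
  have hshift : ∀ h : Config N, P ≤ (∫⁻ X in cellN N L, ENNReal.ofReal (Ψ₀ X ^ 2) * periodicInteraction v L (X + h)) +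
      (CV : ℝ≥0∞) * ∫⁻ Y in cellN N L, ‖Ψ₀ (Y - h) ^ 2 - Ψ₀ Y ^ 2‖ₑ := by
    intro h
    have htr : ∫⁻ X in cellN N L, ENNReal.ofReal (Ψ₀ X ^ 2) * periodicInteraction v L (X + h) =
        ∫⁻ Y in cellN N L, ENNReal.ofReal (Ψ₀ (Y - h) ^ 2) * periodicInteraction v L Y := by
      have := lintegral_cellN_comp_add hL
        (G := fun Y => ENNReal.ofReal (Ψ₀ (Y - h) ^ 2) * periodicInteraction v L Y)
        (fun Y i k => by simp only [add_sub_right_comm, hper, periodicInteraction_add_single]) h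
      simp only [add_sub_cancel_right] at this
      exact this
    rw [htr]
    have hm1 : Measurable fun Y : Config N => ENNReal.ofReal (Ψ₀ (Y - h) ^ 2) * periodicInteraction v L Y :=
      (ENNReal.measurable_ofReal.comp ((hΨm.comp (measurable_sub_const h)).pow_const 2)).mul hVm
    have hmd : Measurable fun Y : Config N => ‖Ψ₀ (Y - h) ^ 2 - Ψ₀ Y ^ 2‖ₑ :=
      (((hΨm.comp (measurable_sub_const h)).pow_const 2).sub (hΨm.pow_const 2)).enorm
    calc P ≤ ∫⁻ Y in cellN N L, (ENNReal.ofReal (Ψ₀ (Y - h) ^ 2) * periodicInteraction v L Y +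
          (CV : ℝ≥0∞) * ‖Ψ₀ (Y - h) ^ 2 - Ψ₀ Y ^ 2‖ₑ) := by
          refine lintegral_mono fun Y => ?_
          have h1 : ENNReal.ofReal (Ψ₀ Y ^ 2) ≤ ENNReal.ofReal (Ψ₀ (Y - h) ^ 2) + ‖Ψ₀ (Y - h) ^ 2 - Ψ₀ Y ^ 2‖ₑ := by
            rw [Real.enorm_eq_ofReal_abs, ← ENNReal.ofReal_add (sq_nonneg _) (abs_nonneg _)]
            exact ENNReal.ofReal_le_ofReal (by linarith [neg_abs_le (Ψ₀ (Y - h) ^ 2 - Ψ₀ Y ^ 2)])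
          calc ENNReal.ofReal (Ψ₀ Y ^ 2) * periodicInteraction v L Y
              ≤ (ENNReal.ofReal (Ψ₀ (Y - h) ^ 2) + ‖Ψ₀ (Y - h) ^ 2 - Ψ₀ Y ^ 2‖ₑ) * periodicInteraction v L Y :=
                mul_le_mul' h1 le_rfl
            _ = ENNReal.ofReal (Ψ₀ (Y - h) ^ 2) * periodicInteraction v L Y +
                ‖Ψ₀ (Y - h) ^ 2 - Ψ₀ Y ^ 2‖ₑ * periodicInteraction v L Y := add_mul _ _ _
            _ ≤ _ := by
                gcongr ?_ + ?_
                · exact le_rfl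
                · rw [mul_comm]; exact mul_le_mul' (hVle Y) le_rfl
      _ = _ := by rw [lintegral_add_left hm1, lintegral_const_mul _ hmd]
  -- expectation of the translation error along the displacement, `s ≤ t`
  have hE : ∀ s : ℝ≥0, s ≤ t → ∫⁻ ω, ∫⁻ Y in cellN N L, ‖Ψ₀ (Y - displacement s ω) ^ 2 - Ψ₀ Y ^ 2‖ₑ ∂volume
      ∂wienerPaths N ≤ ENNReal.ofReal (2 * ε) * I₁ + 2 * ENNReal.ofReal (m / δ) * U := by
    intro s hs
    have hset : MeasurableSet {ω : PathSpace N | δ ≤ ‖displacement s ω‖} :=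
      measurableSet_le measurable_const (measurable_displacement s).norm
    calc ∫⁻ ω, ∫⁻ Y in cellN N L, ‖Ψ₀ (Y - displacement s ω) ^ 2 - Ψ₀ Y ^ 2‖ₑ ∂volume ∂wienerPaths N
        ≤ ∫⁻ ω, (ENNReal.ofReal (2 * ε) * I₁ +
            {h : Config N | δ ≤ ‖h‖}.indicator (fun _ => (2 : ℝ≥0∞)) (displacement s ω) * U) ∂wienerPaths N :=
          lintegral_mono fun ω => setLIntegral_cellN_abs_sq_shift_sub_le hL hΨm hper hε hUC _
      _ = ENNReal.ofReal (2 * ε) * I₁ + 2 * wienerPaths N {ω | δ ≤ ‖displacement s ω‖} * U := by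
          rw [lintegral_add_left (f := fun _ => ENNReal.ofReal (2 * ε) * I₁) measurable_const, lintegral_const,
            measure_univ, mul_one]
          congr 1
          have hind : (fun ω : PathSpace N => {h : Config N | δ ≤ ‖h‖}.indicator (fun _ => (2 : ℝ≥0∞))
              (displacement s ω) * U) = {ω : PathSpace N | δ ≤ ‖displacement s ω‖}.indicator (fun _ => 2 * U) := by
            funext ω
            by_cases hω : δ ≤ ‖displacement s ω‖
            · rw [Set.indicator_of_mem (show displacement s ω ∈ {h : Config N | δ ≤ ‖h‖} from hω),
                Set.indicator_of_mem (show ω ∈ {ω : PathSpace N | δ ≤ ‖displacement s ω‖} from hω)]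
            · rw [Set.indicator_of_notMem (show displacement s ω ∉ {h : Config N | δ ≤ ‖h‖} from hω),
                Set.indicator_of_notMem (show ω ∉ {ω : PathSpace N | δ ≤ ‖displacement s ω‖} from hω), zero_mul]
          rw [hind, lintegral_indicator_const hset]
          ring
      _ ≤ ENNReal.ofReal (2 * ε) * I₁ + 2 * ENNReal.ofReal (m / δ) * U := by
          gcongr
          exact measure_norm_displacement_ge_le_periodic hs hδ
  -- Tonelli and the time integral
  have hJ := setLIntegral_cellN_sq_mul_periodicPathAction_eq hv L hΨm (t : ℝ) (ψ := Ψ₀)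
  -- for `s ∈ (0, t]`: `P ≤ E ∫ Ψ₀² V(· + D_s) + CV · (error)`
  have hstep : ∀ s ∈ Set.Ioc (0 : ℝ) t, P ≤ (∫⁻ ω, ∫⁻ X in cellN N L, ENNReal.ofReal (Ψ₀ X ^ 2) *
      periodicInteraction v L (X + displacement s.toNNReal ω) ∂volume ∂wienerPaths N) +
      (CV : ℝ≥0∞) * (ENNReal.ofReal (2 * ε) * I₁ + 2 * ENNReal.ofReal (m / δ) * U) := by
    intro s hs
    have hs' : s.toNNReal ≤ t := Real.toNNReal_le_iff_le_coe.2 hs.2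
    have hm1 : Measurable fun ω : PathSpace N => ∫⁻ X in cellN N L, ENNReal.ofReal (Ψ₀ X ^ 2) *
        periodicInteraction v L (X + displacement s.toNNReal ω) ∂volume := by
      have : Measurable fun q : PathSpace N × Config N => ENNReal.ofReal (Ψ₀ q.2 ^ 2) *
          periodicInteraction v L (q.2 + displacement s.toNNReal q.1) :=
        (ENNReal.measurable_ofReal.comp ((hΨm.comp measurable_snd).pow_const 2)).mul
          (hVm.comp (measurable_snd.add ((measurable_displacement _).comp measurable_fst)))
      exact this.lintegral_prod_right'
    calc P = ∫⁻ _ω, P ∂wienerPaths N := by rw [lintegral_const, measure_univ, mul_one]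
      _ ≤ ∫⁻ ω, ((∫⁻ X in cellN N L, ENNReal.ofReal (Ψ₀ X ^ 2) * periodicInteraction v L (X + displacement s.toNNReal ω)) +
          (CV : ℝ≥0∞) * ∫⁻ Y in cellN N L, ‖Ψ₀ (Y - displacement s.toNNReal ω) ^ 2 - Ψ₀ Y ^ 2‖ₑ) ∂wienerPaths N :=
          lintegral_mono fun ω => hshift _
      _ = (∫⁻ ω, ∫⁻ X in cellN N L, ENNReal.ofReal (Ψ₀ X ^ 2) * periodicInteraction v L (X + displacement s.toNNReal ω)
            ∂volume ∂wienerPaths N) +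
          (CV : ℝ≥0∞) * ∫⁻ ω, ∫⁻ Y in cellN N L, ‖Ψ₀ (Y - displacement s.toNNReal ω) ^ 2 - Ψ₀ Y ^ 2‖ₑ
            ∂volume ∂wienerPaths N := by
          rw [lintegral_add_left hm1, lintegral_const_mul' _ _ ENNReal.coe_ne_top]
      _ ≤ _ := by
          gcongr
          exact hE _ hs'
  calc ENNReal.ofReal t * P = ∫⁻ _s in Set.Ioc (0 : ℝ) t, P := by
        rw [setLIntegral_const, Real.volume_Ioc, sub_zero, mul_comm]
    _ ≤ ∫⁻ s in Set.Ioc (0 : ℝ) t, ((∫⁻ ω, ∫⁻ X in cellN N L, ENNReal.ofReal (Ψ₀ X ^ 2) *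
          periodicInteraction v L (X + displacement s.toNNReal ω) ∂volume ∂wienerPaths N) +
          (CV : ℝ≥0∞) * (ENNReal.ofReal (2 * ε) * I₁ + 2 * ENNReal.ofReal (m / δ) * U)) :=
        setLIntegral_mono' measurableSet_Ioc hstep
    _ = (∫⁻ s in Set.Ioc (0 : ℝ) t, ∫⁻ ω, ∫⁻ X in cellN N L, ENNReal.ofReal (Ψ₀ X ^ 2) *
          periodicInteraction v L (X + displacement s.toNNReal ω) ∂volume ∂wienerPaths N) +
        ENNReal.ofReal t * ((CV : ℝ≥0∞) * (ENNReal.ofReal (2 * ε) * I₁ + 2 * ENNReal.ofReal (m / δ) * U)) := by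
        rw [lintegral_add_right _ measurable_const, setLIntegral_const, Real.volume_Ioc, sub_zero, mul_comm _
          (ENNReal.ofReal t)]
    _ = _ := by rw [← hJ, ← mul_assoc]

/-! ### The master inequality -/

/-- The cell potential integral of a bounded periodised potential against `Ψ₀²` in real form.
[folklore] -/
theorem setLIntegral_cellN_sq_mul_periodicInteraction_eq_ofReal {v : ℝ → ℝ≥0∞} (hv : Measurable v)
    {L : ℝ} {C : ℝ≥0} (hC : ∀ x, periodizedPotential v L x ≤ C) {Ψ₀ : Config N → ℝ} (hΨm : Measurable Ψ₀)
    (hsq : Integrable (fun X => Ψ₀ X ^ 2) (volume.restrict (cellN N L))) :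
    ∫⁻ X in cellN N L, ENNReal.ofReal (Ψ₀ X ^ 2) * periodicInteraction v L X =
      ENNReal.ofReal (∫ X in cellN N L, Ψ₀ X ^ 2 * (periodicInteraction v L X).toReal) := by
  set CV : ℝ≥0 := (N * N : ℕ) * C with hCVdef
  have hVle : ∀ X : Config N, periodicInteraction v L X ≤ CV := fun X => by
    have := periodicInteraction_le_of_bound (C := (C : ℝ≥0∞)) (fun x => hC x) X
    simpa [hCVdef] using this
  have hVtop : ∀ X : Config N, periodicInteraction v L X ≠ ⊤ := fun X =>
    ne_top_of_le_ne_top ENNReal.coe_ne_top (hVle X)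
  have hVm : Measurable (periodicInteraction (N := N) v L) := measurable_periodicInteraction hv L
  have hint : Integrable (fun X => Ψ₀ X ^ 2 * (periodicInteraction v L X).toReal) (volume.restrict (cellN N L)) := by
    refine (hsq.mul_const (CV : ℝ)).mono' ((hΨm.pow_const 2).mul hVm.ennreal_toReal).aestronglyMeasurable
      (Eventually.of_forall fun X => ?_)
    rw [Real.norm_eq_abs, abs_mul, abs_of_nonneg (sq_nonneg _), abs_of_nonneg ENNReal.toReal_nonneg]
    refine mul_le_mul_of_nonneg_left ?_ (sq_nonneg _)
    have := ENNReal.toReal_mono ENNReal.coe_ne_top (hVle X)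
    simpa using this
  rw [ofReal_integral_eq_lintegral_ofReal hint (Eventually.of_forall fun X =>
    mul_nonneg (sq_nonneg _) ENNReal.toReal_nonneg)]
  refine lintegral_congr fun X => ?_
  rw [ENNReal.ofReal_mul (sq_nonneg _), ENNReal.ofReal_toReal (hVtop X)]

/-- **Master inequality for an eigenfunction pairing on the torus.** For nonnegative measurable
periodic `Ψ₀ ≤ M` with `∫_cell Ψ₀² = 1`, uniform-continuity data `(ε, δ)`, a bounded periodised
potential `v^per ≤ C` and `0 < t` with `N²C t ≤ 1`:
`⟨Ψ₀, e^{-tH}Ψ₀⟩_cell ≤ (1 - sqIncrCell t Ψ₀/2) - t∫_cellΨ₀²V^per + t·N²C·(3ε‖Ψ₀‖₁ + (2 + M‖Ψ₀‖₁) m/δ) + (N²Ct)²`,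
`m = √2·3N·2√t`, `‖Ψ₀‖₁ = ∫_cell Ψ₀`. [folklore] -/
theorem eigen_pairing_upper_bound_periodic {v : ℝ → ℝ≥0∞} (hv : Measurable v) {L : ℝ} (hL : 0 < L)
    {C : ℝ≥0} (hC : ∀ x, periodizedPotential v L x ≤ C) {Ψ₀ : Config N → ℝ} (hΨm : Measurable Ψ₀)
    (hper : ∀ (X : Config N) (i : Fin N) (k : Fin 3),
      Ψ₀ (X + Pi.single i (EuclideanSpace.single k L)) = Ψ₀ X)
    (hnn : ∀ X, 0 ≤ Ψ₀ X) {M : ℝ} (hM : ∀ X, Ψ₀ X ≤ M)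
    (hnorm : ∫ X in cellN N L, Ψ₀ X ^ 2 = 1) {ε δ : ℝ} (hε : 0 ≤ ε) (hδ : 0 < δ)
    (hUC : ∀ Y h, ‖h‖ < δ → |Ψ₀ (Y + h) - Ψ₀ Y| ≤ ε) {t : ℝ≥0} (ht : t ≠ 0)
    (hsmall : ((N * N : ℕ) : ℝ) * C * t ≤ 1) :
    ∫ X in cellN N L, Ψ₀ X * pfkReal v L t Ψ₀ X ≤
      (1 - (sqIncrCell L t Ψ₀).toReal / 2) - t * (∫ X in cellN N L, Ψ₀ X ^ 2 * (periodicInteraction v L X).toReal) +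
        t * ((((N * N : ℕ) : ℝ) * C) * (3 * ε * (∫ X in cellN N L, Ψ₀ X) +
          (2 + M * ∫ X in cellN N L, Ψ₀ X) * (Real.sqrt 2 * ((3 * N : ℕ) * (2 * Real.sqrt t)) / δ))) +
        ((((N * N : ℕ) : ℝ) * C) * t) ^ 2 := by
  have ht0 : (0 : ℝ) ≤ t := t.coe_nonneg
  have ht' : (0 : ℝ) < t := lt_of_le_of_ne ht0 (fun h => ht (by exact_mod_cast h.symm))
  have hM0 : 0 ≤ M := (hnn 0).trans (hM 0)
  have habs : ∀ X, |Ψ₀ X| = Ψ₀ X := fun X => abs_of_nonneg (hnn X)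
  have hMabs : ∀ X, |Ψ₀ X| ≤ M := fun X => by rw [habs]; exact hM X
  have hint : Integrable Ψ₀ (volume.restrict (cellN N L)) := integrable_cellN_of_bound L hΨm hMabs
  have hΨ2 : MemLp Ψ₀ 2 (volume.restrict (cellN N L)) := memLp_two_cellN_of_bound L hΨm hMabs
  set CV : ℝ≥0 := (N * N : ℕ) * C with hCVdef
  have hCVreal : ((N * N : ℕ) : ℝ) * C = CV := by simp [hCVdef]
  set CVt : ℝ := ((N * N : ℕ) : ℝ) * C * t with hCVtdef
  have hCVt0 : 0 ≤ CVt := by positivity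
  set m : ℝ := Real.sqrt 2 * ((3 * N : ℕ) * (2 * Real.sqrt t)) with hm
  have hm0 : 0 ≤ m := by positivity
  set I₁ : ℝ := ∫ X in cellN N L, Ψ₀ X with hI₁def
  have hI₁0 : 0 ≤ I₁ := integral_nonneg hnn
  have hAle : ∀ (X : Config N) (ω : PathSpace N), periodicPathAction v L t X ω ≤ (CV : ℝ≥0∞) * ENNReal.ofReal t := by
    intro X ω
    have := periodicPathAction_le_of_bound (C := (C : ℝ≥0∞)) (fun x => hC x) t X ω
    simpa [hCVdef, mul_assoc] using this
  have hAtop : ∀ (X : Config N) (ω : PathSpace N), periodicPathAction v L t X ω ≠ ⊤ := fun X ω =>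
    periodicPathAction_ne_top hC t X ω
  have hAreal : ∀ (X : Config N) (ω : PathSpace N), (periodicPathAction v L t X ω).toReal ≤ CV * t := by
    intro X ω
    have := ENNReal.toReal_mono (ENNReal.mul_ne_top ENNReal.coe_ne_top ENNReal.ofReal_ne_top) (hAle X ω)
    rwa [ENNReal.toReal_mul, ENNReal.coe_toReal, ENNReal.toReal_ofReal ht0] at this
  have hwl : ∀ (X : Config N) (ω : PathSpace N), worldLine X ω ((t : ℝ)).toNNReal = X + displacement t ω := by
    intro X ω; rw [Real.toNNReal_coe]; rfl
  -- the four integrands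
  set A₁ : Config N → PathSpace N → ℝ := fun X ω => Ψ₀ X * Ψ₀ (X + displacement t ω) with hA₁
  set A₂ : Config N → PathSpace N → ℝ := fun X ω => Ψ₀ X ^ 2 * (periodicPathAction v L t X ω).toReal with hA₂
  set A₃ : Config N → PathSpace N → ℝ := fun X ω =>
    Ψ₀ X * |Ψ₀ (X + displacement t ω) - Ψ₀ X| * CVt with hA₃
  set A₄ : Config N → PathSpace N → ℝ := fun X ω => Ψ₀ X * Ψ₀ (X + displacement t ω) * CVt ^ 2 with hA₄
  -- joint measurability
  have hcompm : Measurable fun p : Config N × PathSpace N => Ψ₀ (p.1 + displacement t p.2) :=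
    hΨm.comp (measurable_fst.add ((measurable_displacement t).comp measurable_snd))
  have h1m : Measurable fun p : Config N × PathSpace N => A₁ p.1 p.2 := (hΨm.comp measurable_fst).mul hcompm
  have h2m : Measurable fun p : Config N × PathSpace N => A₂ p.1 p.2 :=
    ((hΨm.comp measurable_fst).pow_const 2).mul (measurable_periodicPathAction_uncurry hv L t).ennreal_toReal
  have h3m : Measurable fun p : Config N × PathSpace N => A₃ p.1 p.2 :=
    ((hΨm.comp measurable_fst).mul (hcompm.sub (hΨm.comp measurable_fst)).abs).mul_const _
  have h4m : Measurable fun p : Config N × PathSpace N => A₄ p.1 p.2 :=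
    ((hΨm.comp measurable_fst).mul hcompm).mul_const _
  have hwm : Measurable fun p : Config N × PathSpace N =>
      Ψ₀ p.1 * ((periodicFKWeight v L t p.1 p.2).toReal * Ψ₀ (p.1 + displacement t p.2)) :=
    (hΨm.comp measurable_fst).mul ((measurable_periodicFKWeight_uncurry hv L t).ennreal_toReal.mul hcompm)
  -- pointwise bounds by multiples of `|Ψ₀ X|`
  have hdiff : ∀ X ω, |Ψ₀ (X + displacement t ω) - Ψ₀ X| ≤ M := fun X ω =>
    abs_sub_le_iff.2 ⟨by linarith [hM (X + displacement t ω), hnn X], by linarith [hM X, hnn (X + displacement t ω)]⟩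
  have h1b : ∀ X ω, |A₁ X ω| ≤ |Ψ₀ X| * M := fun X ω => by
    simp only [hA₁, abs_mul, habs]; exact mul_le_mul_of_nonneg_left (hM _) (hnn _)
  have h2b : ∀ X ω, |A₂ X ω| ≤ |Ψ₀ X| * (M * (CV * t)) := fun X ω => by
    simp only [hA₂, abs_mul, abs_of_nonneg ENNReal.toReal_nonneg, habs, sq, mul_assoc]
    exact mul_le_mul_of_nonneg_left (mul_le_mul (hM _) (hAreal X ω) ENNReal.toReal_nonneg hM0) (hnn _)
  have h3b : ∀ X ω, |A₃ X ω| ≤ |Ψ₀ X| * (M * CVt) := fun X ω => by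
    simp only [hA₃, abs_mul, abs_abs, habs, abs_of_nonneg hCVt0, mul_assoc]
    exact mul_le_mul_of_nonneg_left (mul_le_mul_of_nonneg_right (hdiff X ω) hCVt0) (hnn _)
  have h4b : ∀ X ω, |A₄ X ω| ≤ |Ψ₀ X| * (M * CVt ^ 2) := fun X ω => by
    simp only [hA₄, abs_mul, habs, abs_of_nonneg (sq_nonneg CVt), mul_assoc]
    exact mul_le_mul_of_nonneg_left (mul_le_mul_of_nonneg_right (hM _) (sq_nonneg _)) (hnn _)
  have hwb : ∀ X ω, |Ψ₀ X * ((periodicFKWeight v L t X ω).toReal * Ψ₀ (X + displacement t ω))| ≤ |Ψ₀ X| * M := by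
    intro X ω
    rw [abs_mul, abs_mul, abs_of_nonneg ENNReal.toReal_nonneg, habs, habs]
    refine mul_le_mul_of_nonneg_left ?_ (hnn X)
    calc (periodicFKWeight v L t X ω).toReal * Ψ₀ (X + displacement t ω) ≤ 1 * M :=
          mul_le_mul (toReal_periodicFKWeight_le_one v L t X ω) (hM _) (hnn _) zero_le_one
      _ = M := one_mul M
  -- inner integrability
  have hinner_int : ∀ (F : Config N → PathSpace N → ℝ) (K : ℝ), (Measurable fun p : Config N × PathSpace N =>
      F p.1 p.2) → (∀ X ω, |F X ω| ≤ |Ψ₀ X| * K) → ∀ X, Integrable (F X) (wienerPaths N) := by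
    intro F K hFm hFb X
    exact Integrable.of_bound (hFm.comp measurable_prodMk_left).aestronglyMeasurable (|Ψ₀ X| * K)
      (Eventually.of_forall fun ω => by rw [Real.norm_eq_abs]; exact hFb X ω)
  have hi1 := hinner_int A₁ _ h1m h1b
  have hi2 := hinner_int A₂ _ h2m h2b
  have hi3 := hinner_int A₃ _ h3m h3b
  have hi4 := hinner_int A₄ _ h4m h4b
  have hiw := hinner_int (fun X ω => Ψ₀ X * ((periodicFKWeight v L t X ω).toReal * Ψ₀ (X + displacement t ω)))
    M hwm hwb
  -- outer integrability
  have hdom : ∀ (F : Config N → PathSpace N → ℝ) (K : ℝ), (Measurable fun p : Config N × PathSpace N =>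
      F p.1 p.2) → (∀ X ω, |F X ω| ≤ |Ψ₀ X| * K) →
      Integrable (fun X => ∫ ω, F X ω ∂wienerPaths N) (volume.restrict (cellN N L)) := by
    intro F K hFm hFb
    refine Integrable.mono' (hint.norm.mul_const K)
      (hFm.stronglyMeasurable.integral_prod_right' (ν := wienerPaths N)).aestronglyMeasurable
      (Eventually.of_forall fun X => ?_)
    have h := norm_integral_le_of_norm_le_const (μ := wienerPaths N) (C := |Ψ₀ X| * K) (f := F X)
      (Eventually.of_forall fun ω => by rw [Real.norm_eq_abs]; exact hFb X ω)
    rwa [probReal_univ, mul_one, ← Real.norm_eq_abs (Ψ₀ X)] at h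
  have hI1 := hdom A₁ _ h1m h1b
  have hI2 := hdom A₂ _ h2m h2b
  have hI3 := hdom A₃ _ h3m h3b
  have hI4 := hdom A₄ _ h4m h4b
  have hIw : Integrable (fun X => Ψ₀ X * pfkReal v L t Ψ₀ X) (volume.restrict (cellN N L)) := by
    refine Integrable.mono' (hint.norm.mul_const M) (hΨm.mul (measurable_pfkReal hv L _ hΨm)).aestronglyMeasurable
      (Eventually.of_forall fun X => ?_)
    simp only [norm_mul, Real.norm_eq_abs]
    exact mul_le_mul_of_nonneg_left (abs_pfkReal_le_of_bound v L _ hMabs X) (abs_nonneg _)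
  -- Step 1: the pairing and the inner inequality
  have hpair : ∀ X, Ψ₀ X * pfkReal v L t Ψ₀ X =
      ∫ ω, Ψ₀ X * ((periodicFKWeight v L t X ω).toReal * Ψ₀ (X + displacement t ω)) ∂wienerPaths N := by
    intro X
    rw [pfkReal, ← MeasureTheory.integral_const_mul]
    refine integral_congr_ae (Eventually.of_forall fun ω => ?_)
    simp only [hwl]
  have hinner : ∀ X, Ψ₀ X * pfkReal v L t Ψ₀ X ≤ (∫ ω, A₁ X ω ∂wienerPaths N) - (∫ ω, A₂ X ω ∂wienerPaths N) +
      (∫ ω, A₃ X ω ∂wienerPaths N) + (∫ ω, A₄ X ω ∂wienerPaths N) := by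
    intro X
    have hs1 : Integrable (fun ω => A₁ X ω - A₂ X ω) (wienerPaths N) := (hi1 X).sub (hi2 X)
    have hs2 : Integrable (fun ω => A₁ X ω - A₂ X ω + A₃ X ω) (wienerPaths N) := hs1.add (hi3 X)
    have hs3 : Integrable (fun ω => A₁ X ω - A₂ X ω + A₃ X ω + A₄ X ω) (wienerPaths N) := hs2.add (hi4 X)
    rw [hpair X, ← integral_sub (hi1 X) (hi2 X), ← integral_add hs1 (hi3 X), ← integral_add hs2 (hi4 X)]
    refine integral_mono (hiw X) hs3 fun ω => ?_
    have := eigen_integrand_le_periodic hC ht0 hsmall hnn X ω (X + displacement t ω)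
    simp only [hA₁, hA₂, hA₃, hA₄, hCVtdef]
    linarith
  -- Step 2: the outer inequality
  have houter : ∫ X in cellN N L, Ψ₀ X * pfkReal v L t Ψ₀ X ≤ (∫ X in cellN N L, ∫ ω, A₁ X ω ∂wienerPaths N) -
      (∫ X in cellN N L, ∫ ω, A₂ X ω ∂wienerPaths N) + (∫ X in cellN N L, ∫ ω, A₃ X ω ∂wienerPaths N) +
      (∫ X in cellN N L, ∫ ω, A₄ X ω ∂wienerPaths N) := by
    have hs1 : Integrable (fun X => (∫ ω, A₁ X ω ∂wienerPaths N) - ∫ ω, A₂ X ω ∂wienerPaths N)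
        (volume.restrict (cellN N L)) := hI1.sub hI2
    have hs2 : Integrable (fun X => (∫ ω, A₁ X ω ∂wienerPaths N) - (∫ ω, A₂ X ω ∂wienerPaths N) +
        ∫ ω, A₃ X ω ∂wienerPaths N) (volume.restrict (cellN N L)) := hs1.add hI3
    have hs3 : Integrable (fun X => (∫ ω, A₁ X ω ∂wienerPaths N) - (∫ ω, A₂ X ω ∂wienerPaths N) +
        (∫ ω, A₃ X ω ∂wienerPaths N) + ∫ ω, A₄ X ω ∂wienerPaths N) (volume.restrict (cellN N L)) := hs2.add hI4
    rw [← integral_sub hI1 hI2, ← integral_add hs1 hI3, ← integral_add hs2 hI4]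
    exact integral_mono hIw hs3 hinner
  -- Step 3: identify the terms
  have hT1 : ∫ X in cellN N L, ∫ ω, A₁ X ω ∂wienerPaths N = 1 - (sqIncrCell L t Ψ₀).toReal / 2 := by
    rw [← hnorm, ← integral_cellN_mul_integral_shift_eq hL hΨm hΨ2 hper t]
    refine integral_congr_ae (Eventually.of_forall fun X => ?_)
    simp only [hA₁]
    exact MeasureTheory.integral_const_mul _ _
  have hT4 : ∫ X in cellN N L, ∫ ω, A₄ X ω ∂wienerPaths N ≤ CVt ^ 2 := by
    have h4eq : ∫ X in cellN N L, ∫ ω, A₄ X ω ∂wienerPaths N =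
        (∫ X in cellN N L, ∫ ω, A₁ X ω ∂wienerPaths N) * CVt ^ 2 := by
      rw [← integral_mul_const]
      refine integral_congr_ae (Eventually.of_forall fun X => ?_)
      show ∫ ω, A₄ X ω ∂wienerPaths N = (∫ ω, A₁ X ω ∂wienerPaths N) * CVt ^ 2
      rw [← integral_mul_const]
    rw [h4eq, hT1]
    have hsq0 : 0 ≤ (sqIncrCell L t Ψ₀).toReal := ENNReal.toReal_nonneg
    nlinarith [sq_nonneg CVt]
  -- the potential term from below
  have hsq_int : Integrable (fun X => Ψ₀ X ^ 2) (volume.restrict (cellN N L)) := hΨ2.integrable_sq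
  have hU : ∫⁻ Y in cellN N L, ENNReal.ofReal (Ψ₀ Y ^ 2) = 1 := by
    rw [← ofReal_integral_eq_lintegral_ofReal hsq_int (Eventually.of_forall fun X => sq_nonneg _), hnorm,
      ENNReal.ofReal_one]
  have hI₁e : ∫⁻ Y in cellN N L, ‖Ψ₀ Y‖ₑ = ENNReal.ofReal I₁ := by
    rw [hI₁def, ofReal_integral_eq_lintegral_ofReal hint (Eventually.of_forall hnn)]
    refine lintegral_congr fun Y => ?_
    rw [Real.enorm_eq_ofReal (hnn Y)]
  have hPot := setLIntegral_cellN_sq_mul_periodicInteraction_eq_ofReal hv hC hΨm hsq_int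
  set Pot : ℝ := ∫ X in cellN N L, Ψ₀ X ^ 2 * (periodicInteraction v L X).toReal with hPotdef
  have hPot0 : 0 ≤ Pot := integral_nonneg fun X => mul_nonneg (sq_nonneg _) ENNReal.toReal_nonneg
  have hT2 : t * Pot ≤ (∫ X in cellN N L, ∫ ω, A₂ X ω ∂wienerPaths N) + t * (CV * (2 * ε * I₁ + 2 * (m / δ))) := by
    -- the double integral of `A₂` as a lower integral
    have h2of : ∀ X ω, ENNReal.ofReal (A₂ X ω) = ENNReal.ofReal (Ψ₀ X ^ 2) * periodicPathAction v L t X ω := by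
      intro X ω
      simp only [hA₂]
      rw [ENNReal.ofReal_mul (sq_nonneg _), ENNReal.ofReal_toReal (hAtop X ω)]
    have hJ2 : ∫ X in cellN N L, ∫ ω, A₂ X ω ∂wienerPaths N =
        (∫⁻ X in cellN N L, ∫⁻ ω, ENNReal.ofReal (Ψ₀ X ^ 2) * periodicPathAction v L t X ω ∂wienerPaths N ∂volume).toReal := by
      have hin : ∀ X, ∫ ω, A₂ X ω ∂wienerPaths N =
          (∫⁻ ω, ENNReal.ofReal (Ψ₀ X ^ 2) * periodicPathAction v L t X ω ∂wienerPaths N).toReal := by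
        intro X
        have h2X : AEStronglyMeasurable (A₂ X) (wienerPaths N) :=
          (h2m.comp measurable_prodMk_left).aestronglyMeasurable
        have h20 : 0 ≤ᵐ[wienerPaths N] A₂ X := Eventually.of_forall fun ω => by
          simp only [hA₂, Pi.zero_apply]; exact mul_nonneg (sq_nonneg _) ENNReal.toReal_nonneg
        rw [integral_eq_lintegral_of_nonneg_ae h20 h2X]
        simp_rw [h2of]
      simp_rw [hin]
      have hFm : Measurable fun X : Config N => ∫⁻ ω, ENNReal.ofReal (Ψ₀ X ^ 2) * periodicPathAction v L t X ω
          ∂wienerPaths N :=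
        ((ENNReal.measurable_ofReal.comp ((hΨm.comp measurable_fst).pow_const 2)).mul
          (measurable_periodicPathAction_uncurry hv L t)).lintegral_prod_right'
      refine integral_toReal hFm.aemeasurable (Eventually.of_forall fun X => ?_)
      calc ∫⁻ ω, ENNReal.ofReal (Ψ₀ X ^ 2) * periodicPathAction v L t X ω ∂wienerPaths N
          ≤ ∫⁻ _ω, ENNReal.ofReal (Ψ₀ X ^ 2) * ((CV : ℝ≥0∞) * ENNReal.ofReal t) ∂wienerPaths N :=
            lintegral_mono fun ω => mul_le_mul' le_rfl (hAle X ω)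
        _ < ⊤ := by
            rw [lintegral_const, measure_univ, mul_one]
            exact ENNReal.mul_lt_top ENNReal.ofReal_lt_top (ENNReal.mul_lt_top ENNReal.coe_lt_top ENNReal.ofReal_lt_top)
    -- the `[0, ∞]` inequality
    have hE := ofReal_mul_potential_le_periodic hv hL hC hΨm hper hε hδ hUC t
    rw [hU, mul_one, hI₁e, hPot] at hE
    -- finiteness
    have hJfin : ∫⁻ X in cellN N L, ∫⁻ ω, ENNReal.ofReal (Ψ₀ X ^ 2) * periodicPathAction v L t X ω ∂wienerPaths N
        ∂volume ≠ ⊤ := by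
      refine ne_of_lt (lt_of_le_of_lt (lintegral_mono fun X => lintegral_mono fun ω =>
        mul_le_mul' le_rfl (hAle X ω)) ?_)
      simp_rw [lintegral_const, measure_univ, mul_one]
      have hm2 : Measurable fun X : Config N => ENNReal.ofReal (Ψ₀ X ^ 2) :=
        ENNReal.measurable_ofReal.comp (hΨm.pow_const 2)
      rw [lintegral_mul_const _ hm2, hU, one_mul]
      exact ENNReal.mul_lt_top ENNReal.coe_lt_top ENNReal.ofReal_lt_top
    have hRfin : ENNReal.ofReal t * (CV : ℝ≥0∞) * (ENNReal.ofReal (2 * ε) * ENNReal.ofReal I₁ +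
        2 * ENNReal.ofReal (m / δ)) ≠ ⊤ :=
      ENNReal.mul_ne_top (ENNReal.mul_ne_top ENNReal.ofReal_ne_top ENNReal.coe_ne_top)
        (ENNReal.add_ne_top.2 ⟨ENNReal.mul_ne_top ENNReal.ofReal_ne_top ENNReal.ofReal_ne_top,
          ENNReal.mul_ne_top ENNReal.ofNat_ne_top ENNReal.ofReal_ne_top⟩)
    have hle := ENNReal.toReal_mono (ENNReal.add_ne_top.2 ⟨hJfin, hRfin⟩) hE
    rw [ENNReal.toReal_mul, ENNReal.toReal_ofReal ht0, ENNReal.toReal_ofReal hPot0,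
      ENNReal.toReal_add hJfin hRfin, ← hJ2] at hle
    have hRe : (ENNReal.ofReal t * (CV : ℝ≥0∞) * (ENNReal.ofReal (2 * ε) * ENNReal.ofReal I₁ +
        2 * ENNReal.ofReal (m / δ))).toReal = t * (CV * (2 * ε * I₁ + 2 * (m / δ))) := by
      rw [ENNReal.toReal_mul, ENNReal.toReal_mul, ENNReal.toReal_ofReal ht0, ENNReal.coe_toReal,
        ENNReal.toReal_add (ENNReal.mul_ne_top ENNReal.ofReal_ne_top ENNReal.ofReal_ne_top)
          (ENNReal.mul_ne_top ENNReal.ofNat_ne_top ENNReal.ofReal_ne_top),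
        ENNReal.toReal_mul, ENNReal.toReal_mul, ENNReal.toReal_ofReal (by positivity),
        ENNReal.toReal_ofReal hI₁0, ENNReal.toReal_ofReal (by positivity), ENNReal.toReal_ofNat]
      ring
    rw [hRe] at hle
    exact hle
  -- the continuity term
  have hT3 : ∫ X in cellN N L, ∫ ω, A₃ X ω ∂wienerPaths N ≤ CVt * (I₁ * (ε + M * (m / δ))) := by
    have hset : MeasurableSet {ω : PathSpace N | δ ≤ ‖displacement t ω‖} :=
      measurableSet_le measurable_const (measurable_displacement t).norm
    have hprob : (wienerPaths N).real {ω | δ ≤ ‖displacement t ω‖} ≤ m / δ := by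
      have := measure_norm_displacement_ge_le_periodic (N := N) (le_refl t) hδ
      have h2 := ENNReal.toReal_mono ENNReal.ofReal_ne_top this
      rwa [ENNReal.toReal_ofReal (by positivity), ← measureReal_def] at h2
    have hin : ∀ X, ∫ ω, A₃ X ω ∂wienerPaths N ≤ Ψ₀ X * (ε + M * (m / δ)) * CVt := by
      intro X
      have hbd : ∀ ω, |Ψ₀ (X + displacement t ω) - Ψ₀ X| ≤
          ε + M * {ω : PathSpace N | δ ≤ ‖displacement t ω‖}.indicator (fun _ => (1 : ℝ)) ω := by
        intro ω
        by_cases hω : ‖displacement t ω‖ < δ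
        · rw [Set.indicator_of_notMem (show ω ∉ {ω : PathSpace N | δ ≤ ‖displacement t ω‖} from
            fun h => absurd h (not_le.2 hω))]
          have := hUC X (displacement t ω) hω
          linarith
        · rw [Set.indicator_of_mem (show ω ∈ {ω : PathSpace N | δ ≤ ‖displacement t ω‖} from not_lt.1 hω)]
          linarith [hdiff X ω]
      have hind_int : Integrable (fun ω => ε + M * {ω : PathSpace N | δ ≤ ‖displacement t ω‖}.indicator
          (fun _ => (1 : ℝ)) ω) (wienerPaths N) :=
        (integrable_const ε).add (((integrable_const (1 : ℝ)).indicator hset).const_mul M)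
      calc ∫ ω, A₃ X ω ∂wienerPaths N = Ψ₀ X * CVt * ∫ ω, |Ψ₀ (X + displacement t ω) - Ψ₀ X| ∂wienerPaths N := by
            simp only [hA₃]
            rw [← MeasureTheory.integral_const_mul]
            refine integral_congr_ae (Eventually.of_forall fun ω => ?_)
            ring
        _ ≤ Ψ₀ X * CVt * ∫ ω, (ε + M * {ω : PathSpace N | δ ≤ ‖displacement t ω‖}.indicator
              (fun _ => (1 : ℝ)) ω) ∂wienerPaths N := by
            refine mul_le_mul_of_nonneg_left (integral_mono ?_ hind_int hbd) (mul_nonneg (hnn X) hCVt0)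
            exact Integrable.of_bound ((hcompm.sub (hΨm.comp measurable_fst)).abs.comp
              measurable_prodMk_left).aestronglyMeasurable M (Eventually.of_forall fun ω => by
                rw [Real.norm_eq_abs, abs_abs]; exact hdiff X ω)
        _ = Ψ₀ X * CVt * (ε + M * (wienerPaths N).real {ω | δ ≤ ‖displacement t ω‖}) := by
            congr 1
            rw [integral_add (integrable_const ε) (((integrable_const (1 : ℝ)).indicator hset).const_mul M),
              MeasureTheory.integral_const, probReal_univ, one_smul, MeasureTheory.integral_const_mul]
            congr 1
            simp only [integral_indicator_const _ hset, smul_eq_mul, mul_one]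
        _ ≤ Ψ₀ X * CVt * (ε + M * (m / δ)) :=
            mul_le_mul_of_nonneg_left (add_le_add le_rfl (mul_le_mul_of_nonneg_left hprob hM0))
              (mul_nonneg (hnn X) hCVt0)
        _ = Ψ₀ X * (ε + M * (m / δ)) * CVt := by ring
    calc ∫ X in cellN N L, ∫ ω, A₃ X ω ∂wienerPaths N ≤ ∫ X in cellN N L, Ψ₀ X * (ε + M * (m / δ)) * CVt :=
          integral_mono hI3 ((hint.mul_const _).mul_const _) hin
      _ = CVt * (I₁ * (ε + M * (m / δ))) := by
          rw [integral_mul_const, integral_mul_const]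
          ring
  -- assemble
  have hfinal : ∫ X in cellN N L, Ψ₀ X * pfkReal v L t Ψ₀ X ≤ (1 - (sqIncrCell L t Ψ₀).toReal / 2) -
      (t * Pot - t * (CV * (2 * ε * I₁ + 2 * (m / δ)))) + CVt * (I₁ * (ε + M * (m / δ))) + CVt ^ 2 := by
    linarith [houter, hT1, hT2, hT3, hT4]
  have hexpand : (1 - (sqIncrCell L t Ψ₀).toReal / 2) - (t * Pot - t * (CV * (2 * ε * I₁ + 2 * (m / δ)))) +
      CVt * (I₁ * (ε + M * (m / δ))) + CVt ^ 2 =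
      (1 - (sqIncrCell L t Ψ₀).toReal / 2) - t * Pot +
        t * ((((N * N : ℕ) : ℝ) * C) * (3 * ε * I₁ + (2 + M * I₁) * (m / δ))) +
        ((((N * N : ℕ) : ℝ) * C) * t) ^ 2 := by
    simp only [hCVtdef, hCVreal]
    ring
  rw [hexpand] at hfinal
  exact hfinal

/-! ### The eventual bound -/

/-- Positive reals from positive `ℝ≥0`: the coercion maps `𝓝[>] 0` to `𝓝[>] 0`. [folklore] -/
theorem tendsto_coe_nhdsGT_zero_periodic :
    Tendsto (fun t : ℝ≥0 => (t : ℝ)) (𝓝[>] (0 : ℝ≥0)) (𝓝[>] (0 : ℝ)) := by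
  refine tendsto_nhdsWithin_iff.2 ⟨?_, ?_⟩
  · have := (NNReal.continuous_coe.tendsto (0 : ℝ≥0))
    simp only [NNReal.coe_zero] at this
    exact this.mono_left nhdsWithin_le_nhds
  · filter_upwards [self_mem_nhdsWithin] with t ht
    exact_mod_cast ht

/-- **The free form of a periodic eigenfunction is asymptotically at most `λ - ∫_cell V^perΨ₀²`.**
For a continuous nonnegative periodic `Ψ₀` with `∫_cell Ψ₀² = 1` satisfying
`e^{-λt} ≤ ⟨Ψ₀, e^{-tH}Ψ₀⟩_cell` for all `t > 0` (integrated eigen-relation), and any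
`K' > λ - ∫_cell Ψ₀² V^per`: eventually as `t → 0⁺`, `sqIncrCell t Ψ₀ / (2t) ≤ K'`.
[cite: ChungZhao1995, Thm 3.27 and Prop 3.29 (81)] -/
theorem sqIncrCell_toReal_eventually_le {v : ℝ → ℝ≥0∞} (hv : Measurable v) {L : ℝ} (hL : 0 < L)
    {C : ℝ≥0} (hC : ∀ x, periodizedPotential v L x ≤ C) {Ψ₀ : Config N → ℝ} (hcont : Continuous Ψ₀)
    (hper : ∀ (X : Config N) (i : Fin N) (k : Fin 3),
      Ψ₀ (X + Pi.single i (EuclideanSpace.single k L)) = Ψ₀ X)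
    (hnn : ∀ X, 0 ≤ Ψ₀ X) (hnorm : ∫ X in cellN N L, Ψ₀ X ^ 2 = 1) {lam : ℝ}
    (heig : ∀ t : ℝ, 0 < t → Real.exp (-(lam * t)) ≤ ∫ X in cellN N L, Ψ₀ X * pfkReal v L t Ψ₀ X) {K' : ℝ}
    (hK' : lam - (∫ X in cellN N L, Ψ₀ X ^ 2 * (periodicInteraction v L X).toReal) < K') :
    ∀ᶠ t : ℝ≥0 in 𝓝[>] 0, (sqIncrCell L t Ψ₀).toReal ≤ 2 * t * K' := by
  -- data of `Ψ₀`
  have hΨm : Measurable Ψ₀ := hcont.measurable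
  obtain ⟨M, hMnn, hMabs⟩ := exists_bound_of_continuous_periodic hL hcont hper
  have hM : ∀ X, Ψ₀ X ≤ M := fun X => (le_abs_self _).trans (hMabs X)
  have hint : Integrable Ψ₀ (volume.restrict (cellN N L)) := integrable_cellN_of_bound L hΨm hMabs
  have hΨ2 : MemLp Ψ₀ 2 (volume.restrict (cellN N L)) := memLp_two_cellN_of_bound L hΨm hMabs
  set I₁ : ℝ := ∫ X in cellN N L, Ψ₀ X with hI₁def
  have hI₁0 : 0 ≤ I₁ := integral_nonneg hnn
  set Pot : ℝ := ∫ X in cellN N L, Ψ₀ X ^ 2 * (periodicInteraction v L X).toReal with hPotdef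
  set CV : ℝ := ((N * N : ℕ) : ℝ) * C with hCVdef
  have hCV0 : 0 ≤ CV := by positivity
  -- the margins
  set η : ℝ := (K' - (lam - Pot)) / 3 with hηdef
  have hη : 0 < η := by rw [hηdef]; linarith
  set ε : ℝ := η / (CV * 3 * I₁ + 1) with hεdef
  have hε : 0 < ε := div_pos hη (by positivity)
  have hε1 : CV * (3 * ε * I₁) ≤ η := by
    have hden : 0 < CV * 3 * I₁ + 1 := by positivity
    have : CV * (3 * ε * I₁) = η * (CV * 3 * I₁ / (CV * 3 * I₁ + 1)) := by
      simp only [hεdef]; field_simp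
    rw [this]
    calc η * (CV * 3 * I₁ / (CV * 3 * I₁ + 1)) ≤ η * 1 := by
          refine mul_le_mul_of_nonneg_left ((div_le_one hden).2 (by linarith)) hη.le
      _ = η := mul_one η
  obtain ⟨δ, hδ, hUC'⟩ := periodic_uniformContinuous hL hcont hper hε
  -- eventual facts in real time
  have hE1 : ∀ᶠ t : ℝ in 𝓝[>] 0, (1 - Real.exp (-(lam * t))) / t < lam + η :=
    (tendsto_order.1 (tendsto_one_sub_exp_div_periodic lam)).2 _ (by linarith)
  have hE2 : ∀ᶠ t : ℝ in 𝓝[>] 0, CV * t < 1 ∧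
      CV * ((2 + M * I₁) * (Real.sqrt 2 * ((3 * N : ℕ) * (2 * Real.sqrt t)) / δ)) + CV ^ 2 * t < η := by
    have hc : Continuous fun t : ℝ => (CV * t,
        CV * ((2 + M * I₁) * (Real.sqrt 2 * ((3 * N : ℕ) * (2 * Real.sqrt t)) / δ)) + CV ^ 2 * t) := by
      fun_prop
    have hopen : IsOpen (Set.Iio (1 : ℝ) ×ˢ Set.Iio η) := isOpen_Iio.prod isOpen_Iio
    have hmem : ((0 : ℝ), (0 : ℝ)) ∈ Set.Iio (1 : ℝ) ×ˢ Set.Iio η :=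
      Set.mk_mem_prod (Set.mem_Iio.2 zero_lt_one) (Set.mem_Iio.2 hη)
    have this := hc.tendsto' 0 ((0 : ℝ), (0 : ℝ)) (by simp)
    have hev := this.eventually (hopen.mem_nhds hmem)
    refine (hev.filter_mono nhdsWithin_le_nhds).mono fun t ht => ?_
    exact ⟨ht.1, ht.2⟩
  have hE := (tendsto_coe_nhdsGT_zero_periodic.eventually hE1).and
    (tendsto_coe_nhdsGT_zero_periodic.eventually hE2)
  filter_upwards [hE, self_mem_nhdsWithin] with t ht htpos
  obtain ⟨h1, h2, h3⟩ := ht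
  have ht0 : t ≠ 0 := ne_of_gt htpos
  have ht' : (0 : ℝ) < t := by exact_mod_cast htpos
  have hsmall : ((N * N : ℕ) : ℝ) * C * t ≤ 1 := by rw [← hCVdef] at *; exact h2.le
  have hmaster := eigen_pairing_upper_bound_periodic hv hL hC hΨm hper hnn hM hnorm hε.le hδ hUC' ht0 hsmall
  have hexp := heig t ht'
  -- `1 - e^{-λt} ≤ t (λ + η)`
  have h1' : 1 - Real.exp (-(lam * t)) ≤ t * (lam + η) := by
    have := (div_lt_iff₀ ht').1 h1
    linarith
  -- the error terms
  set m : ℝ := Real.sqrt 2 * ((3 * N : ℕ) * (2 * Real.sqrt t)) with hm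
  have herr : CV * (3 * ε * I₁ + (2 + M * I₁) * (m / δ)) + CV ^ 2 * t ≤ 2 * η := by
    have := hε1
    nlinarith [h3, hε1]
  -- conclude in `ℝ`
  have hK'eq : K' = lam - Pot + 3 * η := by rw [hηdef]; ring
  rw [← hCVdef] at hmaster
  have key : (sqIncrCell L t Ψ₀).toReal / 2 ≤ t * K' := by
    calc (sqIncrCell L t Ψ₀).toReal / 2 ≤ (1 - Real.exp (-(lam * t))) - t * Pot +
          t * (CV * (3 * ε * I₁ + (2 + M * I₁) * (m / δ))) + (CV * t) ^ 2 := by linarith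
      _ ≤ t * (lam + η) - t * Pot + t * (2 * η) := by nlinarith [h1', herr, ht']
      _ = t * K' := by rw [hK'eq]; ring
  linarith

/-- **The free form of a periodic eigenfunction is asymptotically at most `λ - ∫_cell V^perΨ₀²`**
(`[0, ∞]` form): under the hypotheses of `sqIncrCell_toReal_eventually_le`, for every
`K' > λ - ∫_cell Ψ₀² V^per`, eventually as `t → 0⁺`, `sqIncrCell t Ψ₀ / (2t) ≤ K'`.
[cite: ChungZhao1995, Thm 3.27 and Prop 3.29 (81)] -/
theorem sqIncrCell_div_eventually_le {v : ℝ → ℝ≥0∞} (hv : Measurable v) {L : ℝ} (hL : 0 < L)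
    {C : ℝ≥0} (hC : ∀ x, periodizedPotential v L x ≤ C) {Ψ₀ : Config N → ℝ} (hcont : Continuous Ψ₀)
    (hper : ∀ (X : Config N) (i : Fin N) (k : Fin 3),
      Ψ₀ (X + Pi.single i (EuclideanSpace.single k L)) = Ψ₀ X)
    (hnn : ∀ X, 0 ≤ Ψ₀ X) (hnorm : ∫ X in cellN N L, Ψ₀ X ^ 2 = 1) {lam : ℝ}
    (heig : ∀ t : ℝ, 0 < t → Real.exp (-(lam * t)) ≤ ∫ X in cellN N L, Ψ₀ X * pfkReal v L t Ψ₀ X) {K' : ℝ}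
    (hK' : lam - (∫ X in cellN N L, Ψ₀ X ^ 2 * (periodicInteraction v L X).toReal) < K') :
    ∀ᶠ t : ℝ≥0 in 𝓝[>] 0, (ENNReal.ofReal (2 * t))⁻¹ * sqIncrCell L t Ψ₀ ≤ ENNReal.ofReal K' := by
  obtain ⟨M, -, hMabs⟩ := exists_bound_of_continuous_periodic hL hcont hper
  have hΨ2 : MemLp Ψ₀ 2 (volume.restrict (cellN N L)) := memLp_two_cellN_of_bound L hcont.measurable hMabs
  have hsqfin : ∫⁻ X in cellN N L, ENNReal.ofReal (Ψ₀ X ^ 2) ≠ ⊤ := by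
    rw [← ofReal_integral_eq_lintegral_ofReal hΨ2.integrable_sq (Eventually.of_forall fun X => sq_nonneg _)]
    exact ENNReal.ofReal_ne_top
  filter_upwards [sqIncrCell_toReal_eventually_le hv hL hC hcont hper hnn hnorm heig hK', self_mem_nhdsWithin]
    with t ht htpos
  have hfin : sqIncrCell L t Ψ₀ ≠ ⊤ := (sqIncrCell_lt_top hL hcont.measurable hper hsqfin t).ne
  have h2t : ENNReal.ofReal (2 * t) ≠ 0 :=
    (ENNReal.ofReal_pos.2 (mul_pos two_pos (by exact_mod_cast htpos))).ne'
  rw [ENNReal.inv_mul_le_iff h2t ENNReal.ofReal_ne_top, ← ENNReal.ofReal_toReal hfin,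
    ← ENNReal.ofReal_mul (by positivity)]
  exact ENNReal.ofReal_le_ofReal (by linarith)

/-- **The potential energy of a periodic eigenfunction candidate is at most `λ`**:
`∫_cell Ψ₀² V^per ≤ λ` (the eventual bound `sqIncrCell t Ψ₀ ≤ 2tK'` with `sqIncrCell ≥ 0` forces
`K' ≥ 0` for every `K' > λ - ∫_cellΨ₀²V^per`). [folklore] -/
theorem setIntegral_cellN_sq_mul_periodicInteraction_le {v : ℝ → ℝ≥0∞} (hv : Measurable v) {L : ℝ}
    (hL : 0 < L) {C : ℝ≥0} (hC : ∀ x, periodizedPotential v L x ≤ C) {Ψ₀ : Config N → ℝ}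
    (hcont : Continuous Ψ₀)
    (hper : ∀ (X : Config N) (i : Fin N) (k : Fin 3),
      Ψ₀ (X + Pi.single i (EuclideanSpace.single k L)) = Ψ₀ X)
    (hnn : ∀ X, 0 ≤ Ψ₀ X) (hnorm : ∫ X in cellN N L, Ψ₀ X ^ 2 = 1) {lam : ℝ}
    (heig : ∀ t : ℝ, 0 < t → Real.exp (-(lam * t)) ≤ ∫ X in cellN N L, Ψ₀ X * pfkReal v L t Ψ₀ X) :
    ∫ X in cellN N L, Ψ₀ X ^ 2 * (periodicInteraction v L X).toReal ≤ lam := by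
  by_contra hlt
  push Not at hlt
  set K : ℝ := lam - ∫ X in cellN N L, Ψ₀ X ^ 2 * (periodicInteraction v L X).toReal with hK
  have hK0 : K < 0 := by rw [hK]; linarith
  have hev := sqIncrCell_toReal_eventually_le hv hL hC hcont hper hnn hnorm heig (K' := K / 2) (by linarith)
  obtain ⟨t, ht, htpos⟩ := (hev.and self_mem_nhdsWithin).exists
  have ht' : (0 : ℝ) < t := by exact_mod_cast htpos
  have h0le : 0 ≤ (sqIncrCell L t Ψ₀).toReal := ENNReal.toReal_nonneg
  nlinarith

end Literature.MathematicalPhysics.QuantumManyBody.BoseGas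

end
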